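import Summits.KontsevichZagierPeriods.KontsevichZagierPeriods.Theorems.RootDecompZetaThreeFrontierGZLadderRungThree
import Summits.KontsevichZagierPeriods.KontsevichZagierPeriods.Theorems.RootDecompZetaThreeFrontierWordEdge

/-! # `RootDecompZetaThreeFrontierGenusZeroThreeNormalForm` — crux stmt-KontsevichZagierPeriods-28709 CLOSED

decomp-kz lens-1 g12 §48 (landing kit `HOME/decomp-kz-lens-1/g12/landing/`, critic g5-4 CLEARED FOR LANDING; one-environment certificate
`Kernel28709_v1.lean` sha256 4904f6c7…, critic g4-58 PROVED IN KERNEL, std axioms pinned): the rank-2 crux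
`…Theses.RootDecompZetaThreeFrontier.GenusZeroThreeNormalForm` of route `RootDecompZetaThreeFrontier` is the landed transfer edge
`…Theorems.RootDecompZetaThreeFrontierWordEdge.stub_transfer` (registered stub `stub_transfer` of line «gz_transfer» on 28709, landed p772862) applied to the
landed rung-3 theorem `…GZLadder.RungThree.GZNormalFormWThree_kernel` (item stmt-KontsevichZagierPeriods-32433, `RootDecompZetaThreeFrontierGZLadderRungThree`).
No hypotheses, no `sorry`; landed by census-1 g9 as the `--workitem stmt-KontsevichZagierPeriods-28709` closing file. -/

set_option linter.dupNamespace false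

namespace Summit.KontsevichZagierPeriods.KontsevichZagierPeriods.Cruxes.GenusZeroThreeNormalForm

/-- **CRUX 28709 `GenusZeroThreeNormalForm` OUTRIGHT** [cite: KontsevichZagier2001, §1.2 rules (1)–(3); Brown2009, Cor. 8.3 for the values]: every absolutely
convergent genus-zero period integral on the open ordered 3-simplex with integrand `P(t)/(∏ tᵢ^{bᵢ} ∏ (1−tᵢ)^{cᵢ} ∏_{i<j} (tᵢ−tⱼ)^{aᵢⱼ})`, `P ∈ ℚ[t]`, is congruent
modulo `KZ.relations` to a rational 2-dimensional class of value `a₀ + b₀ζ(2)` plus a multiple `q/(t₀t₁(1−t₂))` of the `ζ(3)` cell — the registered stub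
`stub_gz` (= item 32433, now the theorem `GZNormalFormWThree_kernel`) fed to the landed transfer `stub_transfer`. -/
theorem genusZeroThreeNormalForm_proof :
    Summit.KontsevichZagierPeriods.KontsevichZagierPeriods.Theses.RootDecompZetaThreeFrontier.GenusZeroThreeNormalForm :=
  Summit.KontsevichZagierPeriods.KontsevichZagierPeriods.Theorems.RootDecompZetaThreeFrontierWordEdge.stub_transfer
    Summit.KontsevichZagierPeriods.KontsevichZagierPeriods.Cruxes.GZNormalFormWThree.GZLadder.RungThree.GZNormalFormWThree_kernel

end Summit.KontsevichZagierPeriods.KontsevichZagierPeriods.Cruxes.GenusZeroThreeNormalForm
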